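import Summits.ValiantsHypothesis.ValiantsHypothesis.Theorems.NcPartialDerivative
import Summits.ValiantsHypothesis.ValiantsHypothesis.Theorems.NcCayleyDeterminant
import HarnessLib

/-!
# The pairing polynomial of an involution and its flattening — H4a of O-L6-20 (T2)

The two-letter transfer of the permanent used by the non-skew-depth rung (`NcPairingPermanent`).
For `mate : Fin D → Fin D` the block substitution `pairSubst` sends the variable `x_{i,j}` of
`PERM_D` to the letter `0` if `i = j`, to the letter `1` if `i = mate j`, and to the constant `0`
otherwise; the image of `ncPerPoly K D` under the induced algebra map is the PAIRING POLYNOMIAL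
`pairPoly K mate = Σ_π Π_c pairSubst(π c, c)` (`perm_pairing`). When `mate` is a fixed-point-free
involution, a permutation contributes a word iff it is a product of disjoint transpositions
`(c, mate c)`, and the word records which (`word_pairSubst`); hence `pairPoly` is homogeneous of
degree `D` (`degPart_pairPoly`) and its coefficients are the indicator of the `mate`-invariant words
`w : Fin D → Fin 2` (`coeff_pairPoly`). For a position set `Y` EXCHANGED by `mate`
(`Y (mate c) = ¬ Y c`) the partial-derivative matrix `flat K Y (pairPoly K mate)` (FLOS20 §3.2,
`NcPartialDerivative`) is a permutation matrix: the entry at (row word `u` on `Yᶜ`, column word `v`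
on `Y`) is `[u c = v (mate c) ∀ c]` (`flat_pairPoly`), so its rank is FULL, `2 ^ |Y|`
(`rank_flat_pairPoly`, via `Matrix.rank_submatrix` of the identity). In `NcPairingPermanent` this is
fed, with `Y = sawMask`, `mate = sawMate` (H3b), into the Hankel interval instrument
`hankel_interval_bound` (H2b). INSTRUMENT (substitution side of the rung; the reduction-by-substitution
pattern of HWY10 Lemma C.5 / `NcSOSPermanent.perm_lift`, here onto a two-letter alphabet so that the
instrument's `|σ|^δ` is `2^δ`). MODEL (verbatim for every file): «Circuits ArithCircuit K σ read in FreeAlgebra K σ (ncEval), K a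
field, σ finite; weighted sum gates of any fan-in, product gates of fan-in 1 or 2 (general fan-in:
the landed binz of O-L6-19); the INPUT circuit of a rung is const-free with non-constant output
(print: homogenisation, HWY10 §2 / LMS16 Lemma 4.2 — not formalised; same clause as
ncPerPoly_uptPrint); the instrument (H2) is proved in the wider ZERO-CONST model (const operands
allowed iff 0) so that block substitutions with vanishing entries stay inside it.»
print-KNOWN (FLOS20 §3.2 partial-derivative matrices; LMS16 §6 reduction from the permanent) ·
kernel-NEW · INSTRUMENT · 0 S-currency · closes NO item · A_nc stmt-23446 / PerNotNcVP / VP ≠ VNP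
untouched.
[cite: FijalkowLagardeOhlmannSerre2020, §3.2 (partial-derivative matrix, rank), Theorem 13]
[cite: LimayeMalodSrinivasan2016, Theorem 1.3, §6]
[cite: HrubesWigdersonYehudayoff2010, Lemma C.5 (reduction by substitution)]
-/

noncomputable section

namespace Summit.ValiantsHypothesis.ValiantsHypothesis.Theorems.NcPairingPolynomial

set_option linter.dupNamespace false
open Literature.Computability.AlgebraicComplexity
  Summit.ValiantsHypothesis.ValiantsHypothesis.Theorems.NcSOSDegreeFour
  Summit.ValiantsHypothesis.ValiantsHypothesis.Theorems.NcCentralWidth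
  Summit.ValiantsHypothesis.ValiantsHypothesis.Theorems.NcPartialDerivative
  Summit.ValiantsHypothesis.ValiantsHypothesis.Theorems.NcCayleyDeterminant

universe u

variable (K : Type u) [Field K]

/-! ### §1 The substitution and the pairing polynomial -/

/-- The two-letter block substitution of an involution: `x_{i,j} ↦ 0`-th letter if `i = j`,
`1`-st letter if `i = mate j`, the constant `0` otherwise.
[cite: LimayeMalodSrinivasan2016, §6] [cite: HrubesWigdersonYehudayoff2010, Lemma C.5] -/
def pairSubst {D : ℕ} (mate : Fin D → Fin D) (x : Fin D × Fin D) : Fin 2 ⊕ K :=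
  if x.1 = x.2 then Sum.inl 0 else if x.1 = mate x.2 then Sum.inl 1 else Sum.inr 0

/-- The PAIRING POLYNOMIAL `Σ_π Π_c pairSubst(π c, c)` over the letters `Fin 2`.
[cite: LimayeMalodSrinivasan2016, §6] -/
def pairPoly {D : ℕ} (mate : Fin D → Fin D) : FreeAlgebra K (Fin 2) :=
  ∑ π : Equiv.Perm (Fin D), (List.ofFn fun c : Fin D => ncInputVal (pairSubst K mate (π c, c))).prod

/-- The substitution maps the permanent onto the pairing polynomial.
[cite: HrubesWigdersonYehudayoff2010, Lemma C.5] -/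
theorem perm_pairing {D : ℕ} (mate : Fin D → Fin D) :
    FreeAlgebra.lift K (fun x => ncInputVal (pairSubst K mate x)) (ncPerPoly K D) = pairPoly K mate := by
  rw [ncPerPoly, map_sum]
  simp only [map_list_prod, List.map_ofFn, Function.comp_def, FreeAlgebra.lift_ι_apply]
  rfl

/-- The summand of `π`: a word (letter `0` at the fixed points, `1` at the `mate`-moves) if `π`
moves every point to itself or to its mate, and `0` otherwise.
[cite: LimayeMalodSrinivasan2016, §6] -/
theorem word_pairSubst {D : ℕ} (mate : Fin D → Fin D) (hfp : ∀ c, mate c ≠ c) (π : Equiv.Perm (Fin D)) :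
    (List.ofFn fun c : Fin D => ncInputVal (pairSubst K mate (π c, c))).prod =
      if (∀ c, π c = c ∨ π c = mate c) then
        ((List.ofFn fun c : Fin D => if π c = c then (0 : Fin 2) else 1).map (FreeAlgebra.ι K)).prod
      else 0 := by
  by_cases h : ∀ c, π c = c ∨ π c = mate c
  · rw [if_pos h, List.map_ofFn]
    refine congrArg List.prod (congrArg List.ofFn (funext fun c => ?_))
    simp only [Function.comp_apply, pairSubst]
    rcases h c with hc | hc
    · rw [if_pos hc, if_pos hc]; rfl
    · have hne : π c ≠ c := fun e => hfp c (hc.symm.trans e)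
      rw [if_neg hne, if_pos hc, if_neg hne]; rfl
  · rw [if_neg h]
    obtain ⟨c, hc⟩ := not_forall.mp h
    have h0 : ncInputVal (pairSubst K mate (π c, c)) = 0 := by
      simp only [pairSubst]
      rw [if_neg (fun e => hc (Or.inl e)), if_neg (fun e => hc (Or.inr e))]
      exact map_zero (algebraMap K (FreeAlgebra K (Fin 2)))
    exact List.prod_eq_zero (List.mem_ofFn.2 ⟨c, h0⟩)

/-- `pairPoly` is homogeneous of degree `D`. [cite: FijalkowLagardeOhlmannSerre2020, §3.2] -/
theorem degPart_pairPoly {D : ℕ} (mate : Fin D → Fin D) (hfp : ∀ c, mate c ≠ c) :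
    degPart D D (pairPoly K mate) = pairPoly K mate := by
  unfold pairPoly
  rw [map_sum]
  refine Finset.sum_congr rfl fun π _ => ?_
  rw [word_pairSubst K mate hfp]
  split_ifs
  · rw [degPart_word (le_refl D), if_pos List.length_ofFn]
  · exact map_zero _

/-! ### §2 Coefficients and the flattening -/

/-- The coefficients of the pairing polynomial of a fixed-point-free involution: the indicator of
the `mate`-invariant words. [cite: LimayeMalodSrinivasan2016, §6] -/
theorem coeff_pairPoly {D : ℕ} (mate : Fin D → Fin D) (hm : ∀ c, mate (mate c) = c)
    (hfp : ∀ c, mate c ≠ c) (w : Fin D → Fin 2) :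
    coeff (List.ofFn w) (pairPoly K mate) = if (∀ c, w (mate c) = w c) then 1 else 0 := by
  classical
  -- each summand reads `w` iff `π` is the map `c ↦ (w c = 0 ? c : mate c)`
  have key : ∀ π : Equiv.Perm (Fin D),
      coeff (List.ofFn w) ((List.ofFn fun c : Fin D => ncInputVal (pairSubst K mate (π c, c))).prod) =
        if (∀ c, π c = if w c = 0 then c else mate c) then (1 : K) else 0 := by
    intro π
    rw [word_pairSubst K mate hfp]
    by_cases hg : ∀ c, π c = c ∨ π c = mate c
    · rw [if_pos hg, coeff_word]
      refine if_congr ⟨fun h c => ?_, fun h => ?_⟩ rfl rfl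
      · have hc : (if π c = c then (0 : Fin 2) else 1) = w c := congrFun (List.ofFn_inj.mp h) c
        rcases hg c with e | e
        · rw [if_pos e] at hc
          rw [← hc, if_pos rfl]
          exact e
        · have hne : π c ≠ c := fun e' => hfp c (e.symm.trans e')
          rw [if_neg hne] at hc
          rw [← hc, if_neg (by decide : (1 : Fin 2) ≠ 0)]
          exact e
      · refine List.ofFn_inj.mpr (funext fun c => ?_)
        show (if π c = c then (0 : Fin 2) else 1) = w c
        by_cases hw : w c = 0
        · rw [h c, if_pos hw, if_pos rfl, hw]
        · rw [h c, if_neg hw, if_neg (hfp c), Fin.eq_one_of_ne_zero (w c) hw]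
    · have hne : ¬ ∀ c, π c = if w c = 0 then c else mate c := fun h => hg fun c => by
        by_cases hw : w c = 0
        · exact Or.inl (by rw [h c, if_pos hw])
        · exact Or.inr (by rw [h c, if_neg hw])
      rw [if_neg hg, map_zero, if_neg hne]
  unfold pairPoly
  rw [map_sum, Finset.sum_congr rfl fun π _ => key π]
  by_cases hw : ∀ c, w (mate c) = w c
  · -- the reading map is a (fixed-point-free) involution, hence a permutation: one summand survives
    have hinv : Function.Involutive (fun c : Fin D => if w c = 0 then c else mate c) := by
      intro c
      by_cases h0 : w c = 0
      · simp only [if_pos h0]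
      · have h1 : ¬ w (mate c) = 0 := by rw [hw c]; exact h0
        simp only [if_neg h0, if_neg h1, hm]
    rw [if_pos hw, Finset.sum_eq_single (Function.Involutive.toPerm _ hinv)]
    · exact if_pos fun c => rfl
    · intro π _ hπ
      exact if_neg fun h => hπ (Equiv.ext fun c => by rw [h c, Function.Involutive.coe_toPerm])
    · exact fun h => absurd (Finset.mem_univ _) h
  · -- no permutation reads a non-invariant word
    rw [if_neg hw]
    refine Finset.sum_eq_zero fun π _ => if_neg fun h => hw fun c => ?_
    by_contra hne
    have h1 := h c
    have h2 := h (mate c)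
    rw [hm] at h2
    by_cases h0 : w c = 0
    · have h0' : ¬ w (mate c) = 0 := fun e => hne (e.trans h0.symm)
      rw [if_pos h0] at h1
      rw [if_neg h0'] at h2
      exact hfp c (π.injective (h2.trans h1.symm))
    · have h0' : w (mate c) = 0 := by
        by_contra e
        exact hne ((Fin.eq_one_of_ne_zero _ e).trans (Fin.eq_one_of_ne_zero _ h0).symm)
      rw [if_neg h0] at h1
      rw [if_pos h0'] at h2
      exact hfp c (π.injective (h2.trans h1.symm))

/-- The partial-derivative matrix of the pairing polynomial along a position set exchanged by
`mate`: a permutation matrix. [cite: FijalkowLagardeOhlmannSerre2020, §3.2] -/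
theorem flat_pairPoly {D : ℕ} (Y : Fin D → Bool) (mate : Fin D → Fin D) (hm : ∀ c, mate (mate c) = c)
    (hY : ∀ c, Y (mate c) = !Y c) (u : {i : Fin D // Y i = false} → Fin 2)
    (v : {i : Fin D // Y i = true} → Fin 2) :
    flat K Y (pairPoly K mate) u v =
      if (∀ c : {i : Fin D // Y i = false}, u c = v ⟨mate c.1, by rw [hY, c.2]; rfl⟩) then 1 else 0 := by
  have hfp : ∀ c, mate c ≠ c := fun c h => by
    have h1 := hY c
    rw [h] at h1
    exact (Bool.eq_not_self (Y c)).mp h1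
  rw [flat_apply, mergeWord, coeff_pairPoly K mate hm hfp]
  refine if_congr ⟨fun h c => ?_, fun h c => ?_⟩ rfl rfl
  · -- invariance of the merged word at `c ∈ Yᶜ`
    have hmc : Y (mate c.1) = true := by rw [hY, c.2]; rfl
    have hcc : ¬ Y c.1 = true := by rw [c.2]; exact Bool.false_ne_true
    have e := h c.1
    rw [dif_pos hmc, dif_neg hcc] at e
    exact e.symm
  · rcases Bool.eq_false_or_eq_true (Y c) with hc | hc
    · have hmc : ¬ Y (mate c) = true := by rw [hY, hc]; exact Bool.false_ne_true
      rw [dif_neg hmc, dif_pos hc, h ⟨mate c, Bool.eq_false_iff.mpr hmc⟩]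
      exact congrArg v (Subtype.ext (hm c))
    · have hmc : Y (mate c) = true := by rw [hY, hc]; rfl
      have hcc : ¬ Y c = true := by rw [hc]; exact Bool.false_ne_true
      rw [dif_pos hmc, dif_neg hcc]
      exact (h ⟨c, hc⟩).symm

/-- ★ (H4a) FULL RANK: along a position set exchanged by the involution the partial-derivative
matrix of the pairing polynomial has rank `2 ^ |Y|`. [cite: FijalkowLagardeOhlmannSerre2020, §3.2, Theorem 13] -/
theorem rank_flat_pairPoly {D : ℕ} (Y : Fin D → Bool) (mate : Fin D → Fin D)
    (hm : ∀ c, mate (mate c) = c) (hY : ∀ c, Y (mate c) = !Y c) :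
    (flat K Y (pairPoly K mate)).rank = 2 ^ Fintype.card {i : Fin D // Y i = true} := by
  classical
  have h1 : ∀ c : {i : Fin D // Y i = false}, Y (mate c.1) = true := fun c => by rw [hY, c.2]; rfl
  have h2 : ∀ c : {i : Fin D // Y i = true}, Y (mate c.1) = false := fun c => by rw [hY, c.2]; rfl
  -- the column-to-row bijection `v ↦ v ∘ mate`
  obtain ⟨en, hen⟩ : ∃ en : ({i : Fin D // Y i = true} → Fin 2) ≃ ({i : Fin D // Y i = false} → Fin 2),
      ∀ v c, en v c = v ⟨mate c.1, h1 c⟩ :=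
    ⟨⟨fun v c => v ⟨mate c.1, h1 c⟩, fun u c => u ⟨mate c.1, h2 c⟩,
      fun v => funext fun c => congrArg v (Subtype.ext (hm c.1)),
      fun u => funext fun c => congrArg u (Subtype.ext (hm c.1))⟩, fun v c => rfl⟩
  have hM : flat K Y (pairPoly K mate) =
      (1 : Matrix ({i : Fin D // Y i = false} → Fin 2) ({i : Fin D // Y i = false} → Fin 2) K).submatrix
        (Equiv.refl _) en := by
    ext u v
    rw [flat_pairPoly K Y mate hm hY, Matrix.submatrix_apply, Equiv.refl_apply, Matrix.one_apply]
    exact if_congr ⟨fun h => funext fun c => (h c).trans (hen v c).symm,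
      fun h c => (congrFun h c).trans (hen v c)⟩ rfl rfl
  rw [hM, Matrix.rank_submatrix, Matrix.rank_one, Fintype.card_fun, Fintype.card_fin,
    Fintype.card_congr (⟨fun c => ⟨mate c.1, h1 c⟩, fun c => ⟨mate c.1, h2 c⟩,
      fun c => Subtype.ext (hm c.1), fun c => Subtype.ext (hm c.1)⟩ :
      {i : Fin D // Y i = false} ≃ {i : Fin D // Y i = true})]

end Summit.ValiantsHypothesis.ValiantsHypothesis.Theorems.NcPairingPolynomial
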